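import Literature.NumberTheory.GaloisRepresentations.SuperellipticTwistLefschetz
import Literature.NumberTheory.GaloisRepresentations.SuperellipticGoodReductionThree
import HarnessLib

/-!
# Galois representations attached to Picard curves: the good-reduction hypothesis `hX2` eliminated

The conditional theorems of `PicardLambdaAdicRepLocal` / `…Divisible` / `…Chebotarev` / `…Weil` /
`SuperellipticTwistLefschetz` take as a hypothesis `hX2` the good-reduction datum for the divisor class groups
of the curves `y^p = f(x)` (an equivariant reduction map onto `Pic` of the reduced curve, bijective on the torsion
prime to the residue characteristic; Serre–Tate 1968 §1, quoted there for Jacobians).  For `p = 3` and the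
`3`-power torsion — which is all these files use — that datum is now a theorem,
`superelliptic_three_exists_reduction` (Deuring's explicit reduction, `SuperellipticGoodReductionThree`).  This
file re-derives the part of that theory which leads to `picardCurve_exists_lambdaAdicRep` WITHOUT `hX2` (same
statements and proofs, in the suffix `_deuring`, the datum supplied by the theorem):

* `picard_exists_reduction_bij`, `picardRho1_isUnramifiedAt`,
  `trace_dual_picardRho1_frob_inv_of_card`, `picard_finrank_tateModule_eq_zero_or_eq_six`,
  `picard_nontrivial_tateModule`, …;
* **`picardCurve_exists_lambdaAdicRep_of_lefschetz hX3`**: all clauses of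
  `picardCurve_exists_lambdaAdicRep` from the twisted Lefschetz trace formula `hX3` ALONE;
* **`picardCurve_exists_lambdaAdicRep_of_weil hW`**: the same from Weil's (untwisted) trace formula
  `#C_f(𝔽_q) = q + 1 - Tr(Frob | V_ℓ Pic(C_{f, 𝔽̄_q}))` for the curves `y^p = f(x)` over finite fields
  (Milne, *Jacobian varieties*, Thm. 11.1) — the one remaining input.

## References
* [cite: Upton2009, Thm. 2.1 and §4]
* [cite: Deuring1942Reduktion, §4]
* [cite: SerreTate1968GoodReduction, §1]
* [cite: Milne1986JacobianVarieties, §11]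
-/

noncomputable section

open Polynomial
open scoped Classical

namespace Literature.NumberTheory.GaloisRepresentations

open Literature.NumberTheory.EllipticCurves Literature.NumberTheory.DiophantineGeometry
  Literature.NumberTheory.DiophantineGeometry.AlgFunctionField SuperellipticFunctionField Field IsDedekindDomain
open scoped NumberField Pointwise

attribute [local instance] Ideal.Quotient.field

set_option synthInstance.maxHeartbeats 160000


section PicardLocal

variable (K : Type) [Field K] [NumberField K] [IsCyclotomicExtension {3} ℚ K]
variable (f : ℤ[X]) [hf4 : Fact (f.natDegree = 4)] [hfs : Fact (f.map (Int.castRingHom ℚ)).Separable]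

attribute [local instance] fact_irreducible_picard_inst picardEisensteinModule picard_isScalarTower_inst
  picard_smulCommClass_inst

variable {K f}

variable
  (hX3 : ∀ (k : Type) [Field k] [Fintype k] (Ω : Type) [Field Ω] [Algebra k Ω] [IsAlgClosed Ω]
    [Algebra.IsAlgebraic k Ω] (p : ℕ) [Fact p.Prime] (ℓ : ℕ) [Fact ℓ.Prime] (f : k[X]),
    (p : k) ≠ 0 → (ℓ : k) ≠ 0 → f.Separable → ¬ p ∣ f.natDegree →
    ∀ [Fact (Irreducible (superellipticPoly k Ω p f))] (φ : Ω ≃ₐ[k] Ω), (∀ x : Ω, φ x = x ^ Fintype.card k) →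
    ∀ (ξ : CyclicCoverDeck Ω p),
      LinearMap.trace ℚ_[ℓ] (RationalTateModule (SuperellipticPic k Ω p f) ℓ)
        (rationalTateRepresentation (Ω ≃ₐ[k] Ω) (SuperellipticPic k Ω p f) ℓ φ ∘ₗ
          rationalTateRepresentation (CyclicCoverDeck Ω p) (SuperellipticPic k Ω p f) ℓ ξ) =
        (Fintype.card k : ℚ_[ℓ]) + 1 -
          Nat.card {P : PlaceOver Ω (SuperellipticFunctionField k Ω p f) // φ • (ξ • P) = P})

section GoodPrime

variable {𝔭 : HeightOneSpectrum (𝓞 K)} (h3𝔭 : (3 : 𝓞 K) ∉ 𝔭.asIdeal)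
  (hdeg𝔭 : (f.map ((Ideal.Quotient.mk 𝔭.asIdeal).comp (algebraMap ℤ (𝓞 K)))).natDegree = 4)
  (hsep𝔭 : (f.map ((Ideal.Quotient.mk 𝔭.asIdeal).comp (algebraMap ℤ (𝓞 K)))).Separable)
  {𝔓 : Ideal (absIntegers (𝓞 K) K)} [𝔓.IsMaximal] [h𝔓over : 𝔓.LiesOver 𝔭.asIdeal]

include h3𝔭 hdeg𝔭 hsep𝔭 in
/-- **The good-reduction datum for the Picard curve at `𝔭 ∤ 3` of good reduction, with both halves of the
torsion clause** (injective and surjective on `3`-power torsion) — the statement of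
`PicardLambdaAdicRepDivisible.picard_exists_reduction_bij`, now UNCONDITIONAL: the datum is Deuring's explicit
reduction map (`superelliptic_three_exists_reduction`). [cite: Deuring1942Reduktion, §4]
[cite: SerreTate1968GoodReduction, §1, Lemma 2 and Thm. 1] -/
private theorem picard_exists_reduction_bij_deuring :
    haveI := fact_irreducible_reduction_inst (K := K) (f := f) hdeg𝔭 hsep𝔭 (𝔓 := 𝔓)
    ∃ red : GeomPic K 3 (f.map (algebraMap ℤ K)) →+
        SuperellipticPic (𝓞 K ⧸ 𝔭.asIdeal) (absIntegers (𝓞 K) K ⧸ 𝔓) 3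
          ((f.map (algebraMap ℤ (𝓞 K))).map (Ideal.Quotient.mk 𝔭.asIdeal)),
      (∀ (τ : MulAction.stabilizer (absoluteGaloisGroup K) 𝔓) (c : GeomPic K 3 (f.map (algebraMap ℤ K))),
          red ((τ : absoluteGaloisGroup K) • c) =
            (Ideal.Quotient.stabilizerHom 𝔓 𝔭.asIdeal (absoluteGaloisGroup K) τ) • red c) ∧
      (∀ (ζ : CyclicCoverDeck (AlgebraicClosure K) 3) (c : GeomPic K 3 (f.map (algebraMap ℤ K))),
          red (ζ • c) = CyclicCoverDeck.reduceMod K 3 𝔓 ζ • red c) ∧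
      (∀ (n : ℕ) (c : GeomPic K 3 (f.map (algebraMap ℤ K))), 3 ^ n • c = 0 → red c = 0 → c = 0) ∧
      (∀ (n : ℕ) c', 3 ^ n • c' = 0 → ∃ c : GeomPic K 3 (f.map (algebraMap ℤ K)), 3 ^ n • c = 0 ∧ red c = c') := by
  haveI := fact_irreducible_reduction_inst (K := K) (f := f) hdeg𝔭 hsep𝔭 (𝔓 := 𝔓)
  exact superelliptic_three_exists_reduction K (isPrimitiveRoot_zeta3 K) (f.map (algebraMap ℤ K))
    (f.map (algebraMap ℤ (𝓞 K))) (map_map_algebraMap_ringOfIntegers K f) (separable_map_algebraMap_int K hfs.out)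
    𝔭 𝔓 h3𝔭 (not_three_dvd_natDegree_map K hf4.out)
    (by rw [map_map_mk_ringOfIntegers, hdeg𝔭, natDegree_map_algebraMap_int_eq K hf4.out])
    (by rw [map_map_mk_ringOfIntegers]; exact hsep𝔭)

include h3𝔭 hdeg𝔭 hsep𝔭 in
/-- **The good-reduction datum for the Picard curve at `𝔭 ∤ 3` of good reduction** (injective half), unconditional.
[cite: Deuring1942Reduktion, §4] [cite: SerreTate1968GoodReduction, §1, Lemma 2 and Thm. 1] -/
private theorem picard_exists_reduction_deuring :
    haveI := fact_irreducible_reduction_inst (K := K) (f := f) hdeg𝔭 hsep𝔭 (𝔓 := 𝔓)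
    ∃ red : GeomPic K 3 (f.map (algebraMap ℤ K)) →+
        SuperellipticPic (𝓞 K ⧸ 𝔭.asIdeal) (absIntegers (𝓞 K) K ⧸ 𝔓) 3
          ((f.map (algebraMap ℤ (𝓞 K))).map (Ideal.Quotient.mk 𝔭.asIdeal)),
      (∀ (τ : MulAction.stabilizer (absoluteGaloisGroup K) 𝔓) (c : GeomPic K 3 (f.map (algebraMap ℤ K))),
          red ((τ : absoluteGaloisGroup K) • c) =
            (Ideal.Quotient.stabilizerHom 𝔓 𝔭.asIdeal (absoluteGaloisGroup K) τ) • red c) ∧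
      (∀ (ζ : CyclicCoverDeck (AlgebraicClosure K) 3) (c : GeomPic K 3 (f.map (algebraMap ℤ K))),
          red (ζ • c) = CyclicCoverDeck.reduceMod K 3 𝔓 ζ • red c) ∧
      (∀ (n : ℕ) (c : GeomPic K 3 (f.map (algebraMap ℤ K))), 3 ^ n • c = 0 → red c = 0 → c = 0) := by
  obtain ⟨red, hτ, hζ, hinj, -⟩ := picard_exists_reduction_bij_deuring (K := K) (f := f) h3𝔭 hdeg𝔭 hsep𝔭 (𝔓 := 𝔓)
  exact ⟨red, hτ, hζ, hinj⟩

include h3𝔭 hdeg𝔭 hsep𝔭 in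
/-- **`ρ₁` is unramified at a prime `𝔭 ∤ 3` of good reduction**: the inertia group at `𝔓 ∣ 𝔭` acts
trivially on the reduction `Pic(C̄)`, hence (reduction being injective on `3`-power torsion) on
`T₃ J(C_f)` — the criterion of Néron–Ogg–Shafarevich, easy direction (Serre–Tate Thm. 1).
[cite: SerreTate1968GoodReduction, §1, Thm. 1] [cite: Upton2009, §2] -/
private theorem picardRho1_isUnramifiedAt_deuring
    (hcard : ∀ n, Nat.card (AddSubgroup.torsionBy (GeomPic K 3 (f.map (algebraMap ℤ K))) (3 ^ n : ℕ)) = 3 ^ (2 * 3 * n))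
    (b : Module.Basis (Fin 3) PadicEisenstein (TateModule (GeomPic K 3 (f.map (algebraMap ℤ K))) 3))
    (u : PadicAlgCl 3) (hu : u ^ 2 + u + 1 = 0) :
    (picardRho1 hcard b u hu).IsUnramifiedAt 𝔭 := by
  intro 𝔓 h𝔓 σ hσ
  haveI := HeightOneSpectrum.isMaximal_of_mem_primesAbove h𝔓
  haveI : 𝔓.LiesOver 𝔭.asIdeal := h𝔓.2
  obtain ⟨red, hτ, -, hinj⟩ := picard_exists_reduction_deuring (K := K) (f := f) h3𝔭 hdeg𝔭 hsep𝔭 (𝔓 := 𝔓)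
  -- the inertia element `σ` acts trivially on the reduction, hence on `T`
  have hσD : σ ∈ MulAction.stabilizer (absoluteGaloisGroup K) 𝔓 := Ideal.inertia_le_stabilizer 𝔓 hσ
  have hone : Ideal.Quotient.stabilizerHom 𝔓 𝔭.asIdeal (absoluteGaloisGroup K) ⟨σ, hσD⟩ = 1 := by
    rw [← MonoidHom.mem_ker, Ideal.Quotient.ker_stabilizerHom]
    exact hσ
  have hfix : ∀ t : TateModule (GeomPic K 3 (f.map (algebraMap ℤ K))) 3, σ • t = t :=
    TateModule.smul_eq_self_of_reduction red hinj σ fun c => by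
      have h := hτ ⟨σ, hσD⟩ c
      rwa [hone, one_smul] at h
  refine Units.ext (Matrix.ext fun i j => ?_)
  rw [picardRho1_apply_coe, picardMatrixRepO_apply, hfix, b.repr_self, Finsupp.single_apply, Units.val_one,
    Matrix.one_apply]
  by_cases h : i = j
  · subst h
    rw [if_pos rfl, if_pos rfl, map_one]
  · rw [if_neg (Ne.symm h), if_neg h, map_zero]

include h3𝔭 hdeg𝔭 hsep𝔭 in
/-- **The special fibre has the same torsion counts as the generic fibre**: `#Pic(C̄)[3ⁿ] = #J_f[3ⁿ]`,
the good-reduction datum being bijective on `3`-power torsion (Serre–Tate §1 Lemma 2) — so the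
structure theorem `hX1` is not needed on the special fibre. [cite: SerreTate1968GoodReduction, §1, Lemma 2] -/
private theorem card_torsionBy_reduction_eq_deuring (n : ℕ) :
    haveI := fact_irreducible_reduction_inst (K := K) (f := f) hdeg𝔭 hsep𝔭 (𝔓 := 𝔓)
    Nat.card (AddSubgroup.torsionBy (SuperellipticPic (𝓞 K ⧸ 𝔭.asIdeal) (absIntegers (𝓞 K) K ⧸ 𝔓) 3
      ((f.map (algebraMap ℤ (𝓞 K))).map (Ideal.Quotient.mk 𝔭.asIdeal))) (3 ^ n : ℕ)) =
      Nat.card (AddSubgroup.torsionBy (GeomPic K 3 (f.map (algebraMap ℤ K))) (3 ^ n : ℕ)) := by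
  haveI := fact_irreducible_reduction_inst (K := K) (f := f) hdeg𝔭 hsep𝔭 (𝔓 := 𝔓)
  obtain ⟨red, -, -, hinj, hsurj⟩ := picard_exists_reduction_bij_deuring (K := K) (f := f) h3𝔭 hdeg𝔭 hsep𝔭 (𝔓 := 𝔓)
  symm
  refine Nat.card_congr (Equiv.ofBijective
    (fun c => ⟨red c, AddSubgroup.torsionBy.nsmul_iff.2 (by
      rw [← map_nsmul, AddSubgroup.torsionBy.nsmul_iff.1 c.2, map_zero])⟩) ⟨?_, ?_⟩)
  · rintro ⟨c₁, hc₁⟩ ⟨c₂, hc₂⟩ h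
    have h' : red (c₁ - c₂) = 0 := by
      rw [map_sub, sub_eq_zero]
      exact congrArg Subtype.val h
    have h3 : 3 ^ n • (c₁ - c₂) = 0 := by
      rw [smul_sub, AddSubgroup.torsionBy.nsmul_iff.1 hc₁, AddSubgroup.torsionBy.nsmul_iff.1 hc₂, sub_self]
    exact Subtype.ext (sub_eq_zero.1 (hinj n _ h3 h'))
  · rintro ⟨c', hc'⟩
    obtain ⟨c, hc, hcc'⟩ := hsurj n c' (AddSubgroup.torsionBy.nsmul_iff.1 hc')
    exact ⟨⟨c, AddSubgroup.torsionBy.nsmul_iff.2 hc⟩, Subtype.ext hcc'⟩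

include hX3 h3𝔭 hdeg𝔭 hsep𝔭 in
set_option maxHeartbeats 800000 in
/-- **`tr_{ℤ₃}(τ δ^i | T₃ J(C_f))` at a Frobenius `τ` is the twisted point count** — the theorem
`picard_trace_frob_deck` of `PicardLambdaAdicRepLocal` run from the count `#J_f[3ⁿ] = 3^{6n}` (`hcard`)
instead of `hX1`: the count of the special fibre is transported along the bijective reduction datum
(`card_torsionBy_reduction_eq_deuring`); then transfer of traces (`trace_eq_of_injective_of_comp_eq`), the twisted
Lefschetz trace formula (`hX3`), fixed places of `Frob ∘ δ̄^i` (`card_fixedPlaces_frobenius_deck`) and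
cubic character sums (`picard_twistedCount_eq_characterSum`), verbatim.
[cite: Upton2009, §2] [cite: Milne1986JacobianVarieties, §11 Prop. 11.2] -/
private theorem picard_trace_frob_deck_of_card_deuring
    (hcard : ∀ n, Nat.card (AddSubgroup.torsionBy (GeomPic K 3 (f.map (algebraMap ℤ K))) (3 ^ n : ℕ)) = 3 ^ (2 * 3 * n))
    (τ : absoluteGaloisGroup K) (hτ : IsArithFrobAt (𝓞 K) τ 𝔓) {i : ℕ} (hi : i < 3) :
    ∃ m : ℤ,
      LinearMap.trace ℤ_[3] _
        (DistribSMul.toLinearMap ℤ_[3] (TateModule (GeomPic K 3 (f.map (algebraMap ℤ K))) 3) τ ∘ₗ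
          DistribSMul.toLinearMap ℤ_[3] (TateModule (GeomPic K 3 (f.map (algebraMap ℤ K))) 3)
            (deckGen (isPrimitiveRoot_zeta3 K) ^ i)) = m ∧
      (m : 𝓞 K) = (zeta3Int K ^ i) ^ 2 * picardTrace f 𝔭 + zeta3Int K ^ i * picardTrace (f ^ 2) 𝔭 := by
  classical
  haveI : Fact (Nat.Prime 3) := ⟨Nat.prime_three⟩
  haveI := fact_irreducible_reduction_inst (K := K) (f := f) hdeg𝔭 hsep𝔭 (𝔓 := 𝔓)
  letI : Fintype (𝓞 K ⧸ 𝔭.asIdeal) := Fintype.ofFinite (𝓞 K ⧸ 𝔭.asIdeal)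
  haveI : IsAlgClosed (absIntegers (𝓞 K) K ⧸ 𝔓) := absIntegers.isAlgClosed_quotient 𝔓
  haveI : Algebra.IsAlgebraic (𝓞 K ⧸ 𝔭.asIdeal) (absIntegers (𝓞 K) K ⧸ 𝔓) := inferInstance
  have hfb' : ((f.map (algebraMap ℤ (𝓞 K))).map (Ideal.Quotient.mk 𝔭.asIdeal)) = f.map ((Ideal.Quotient.mk 𝔭.asIdeal).comp (algebraMap ℤ (𝓞 K))) :=
    map_map_mk_ringOfIntegers K f 𝔭
  have h3k : (3 : (𝓞 K ⧸ 𝔭.asIdeal)) ≠ 0 := three_ne_zero_residue h3𝔭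
  have hq : Fintype.card (𝓞 K ⧸ 𝔭.asIdeal) = 𝔭.residueCard := by
    rw [HeightOneSpectrum.residueCard_eq_card_quotient, Nat.card_eq_fintype_card]
  have hdegb : ((f.map (algebraMap ℤ (𝓞 K))).map (Ideal.Quotient.mk 𝔭.asIdeal)).natDegree = 4 := by rw [hfb']; exact hdeg𝔭
  have hsepb : ((f.map (algebraMap ℤ (𝓞 K))).map (Ideal.Quotient.mk 𝔭.asIdeal)).Separable := by rw [hfb']; exact hsep𝔭
  have hndvdb : ¬ 3 ∣ ((f.map (algebraMap ℤ (𝓞 K))).map (Ideal.Quotient.mk 𝔭.asIdeal)).natDegree := by rw [hdegb]; decide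
  have hpq : 3 ∣ Fintype.card (𝓞 K ⧸ 𝔭.asIdeal) - 1 := by
    rw [hq]; exact three_dvd_residueCard_sub_one (isPrimitiveRoot_zeta3Int K) h3𝔭
  -- the reduction datum and ranks (special fibre count from the bijection, not from `hX1`)
  obtain ⟨red, hredτ, hredζ, hinj⟩ := picard_exists_reduction_deuring (K := K) (f := f) h3𝔭 hdeg𝔭 hsep𝔭 (𝔓 := 𝔓)
  have hcard' : ∀ n, Nat.card (AddSubgroup.torsionBy (SuperellipticPic (𝓞 K ⧸ 𝔭.asIdeal) (absIntegers (𝓞 K) K ⧸ 𝔓) 3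
      ((f.map (algebraMap ℤ (𝓞 K))).map (Ideal.Quotient.mk 𝔭.asIdeal))) (3 ^ n : ℕ)) = 3 ^ (2 * 3 * n) := fun n => by
    rw [card_torsionBy_reduction_eq_deuring (K := K) (f := f) h3𝔭 hdeg𝔭 hsep𝔭 (𝔓 := 𝔓) n, hcard n]
  haveI := TateModule.free_of_card_torsionBy_rank hcard
  haveI := TateModule.finite_of_card_torsionBy_rank hcard
  haveI := TateModule.free_of_card_torsionBy_rank hcard'
  haveI := TateModule.finite_of_card_torsionBy_rank hcard'
  have hrank : Module.finrank ℤ_[3] (TateModule (GeomPic K 3 (f.map (algebraMap ℤ K))) 3) =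
      Module.finrank ℤ_[3] (TateModule (SuperellipticPic (𝓞 K ⧸ 𝔭.asIdeal) (absIntegers (𝓞 K) K ⧸ 𝔓) 3 ((f.map (algebraMap ℤ (𝓞 K))).map (Ideal.Quotient.mk 𝔭.asIdeal))) 3) := by
    rw [TateModule.finrank_eq_of_card_torsionBy hcard, TateModule.finrank_eq_of_card_torsionBy hcard']
  -- the Frobenius automorphism of `κ(𝔓)` and the reduced deck transformation
  set φ : (absIntegers (𝓞 K) K ⧸ 𝔓) ≃ₐ[(𝓞 K ⧸ 𝔭.asIdeal)] (absIntegers (𝓞 K) K ⧸ 𝔓) :=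
    Ideal.Quotient.stabilizerHom 𝔓 𝔭.asIdeal (absoluteGaloisGroup K) ⟨τ, hτ.mem_stabilizer⟩ with hφdef
  have hφ : ∀ x : (absIntegers (𝓞 K) K ⧸ 𝔓), φ x = x ^ Fintype.card (𝓞 K ⧸ 𝔭.asIdeal) := stabilizerHom_apply_eq_pow (K := K) τ hτ
  set ξ : CyclicCoverDeck (absIntegers (𝓞 K) K ⧸ 𝔓) 3 := CyclicCoverDeck.reduceMod K 3 𝔓 (deckGen (isPrimitiveRoot_zeta3 K) ^ i) with hξdef
  -- transfer of the trace to the special fibre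
  have htransfer : LinearMap.trace ℤ_[3] _
      (DistribSMul.toLinearMap ℤ_[3] (TateModule (GeomPic K 3 (f.map (algebraMap ℤ K))) 3) τ ∘ₗ
        DistribSMul.toLinearMap ℤ_[3] (TateModule (GeomPic K 3 (f.map (algebraMap ℤ K))) 3)
          (deckGen (isPrimitiveRoot_zeta3 K) ^ i)) =
      LinearMap.trace ℤ_[3] _
        (DistribSMul.toLinearMap ℤ_[3] (TateModule (SuperellipticPic (𝓞 K ⧸ 𝔭.asIdeal) (absIntegers (𝓞 K) K ⧸ 𝔓) 3 ((f.map (algebraMap ℤ (𝓞 K))).map (Ideal.Quotient.mk 𝔭.asIdeal))) 3) φ ∘ₗ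
          DistribSMul.toLinearMap ℤ_[3] (TateModule (SuperellipticPic (𝓞 K ⧸ 𝔭.asIdeal) (absIntegers (𝓞 K) K ⧸ 𝔓) 3 ((f.map (algebraMap ℤ (𝓞 K))).map (Ideal.Quotient.mk 𝔭.asIdeal))) 3) ξ) :=
    trace_eq_of_injective_of_comp_eq hrank (TateModule.map 3 red)
      (TateModule.map_injective_of_forall_torsionBy red hinj) _ _
      (TateModule.map_comp_toLinearMap_eq red τ φ (fun c => hredτ ⟨τ, hτ.mem_stabilizer⟩ c) _ ξ
        (fun c => hredζ _ c))
  -- twisted Lefschetz on `V₃` of the special fibre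
  have hlef := hX3 (𝓞 K ⧸ 𝔭.asIdeal) (absIntegers (𝓞 K) K ⧸ 𝔓) 3 3 ((f.map (algebraMap ℤ (𝓞 K))).map (Ideal.Quotient.mk 𝔭.asIdeal)) (by exact_mod_cast h3k) (by exact_mod_cast h3k) hsepb hndvdb φ hφ ξ
  rw [trace_rationalTateRepresentation_comp] at hlef
  -- the fixed places of `Frob ∘ δ̄^i`
  have hfix := SuperellipticFunctionField.card_fixedPlaces_frobenius_deck (k := (𝓞 K ⧸ 𝔭.asIdeal)) (Ω := (absIntegers (𝓞 K) K ⧸ 𝔓)) (p := 3) (f := ((f.map (algebraMap ℤ (𝓞 K))).map (Ideal.Quotient.mk 𝔭.asIdeal))) φ hφ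
    (by exact_mod_cast h3k) hsepb hndvdb hpq ξ
  -- the label condition in the two spellings
  have hξval : ξ.val = algebraMap (𝓞 K ⧸ 𝔭.asIdeal) (absIntegers (𝓞 K) K ⧸ 𝔓) (Ideal.Quotient.mk 𝔭.asIdeal (zeta3Int K ^ i)) :=
    val_reduceMod_deckGen_pow (K := K) (𝔓 := 𝔓) i
  have hfilter : (Finset.univ.filter fun a : (𝓞 K ⧸ 𝔭.asIdeal) => ((f.map (algebraMap ℤ (𝓞 K))).map (Ideal.Quotient.mk 𝔭.asIdeal)).eval a ≠ 0 ∧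
      algebraMap (𝓞 K ⧸ 𝔭.asIdeal) (absIntegers (𝓞 K) K ⧸ 𝔓) (((f.map (algebraMap ℤ (𝓞 K))).map (Ideal.Quotient.mk 𝔭.asIdeal)).eval a) ^ ((Fintype.card (𝓞 K ⧸ 𝔭.asIdeal) - 1) / 3) = ξ.val) =
      (Finset.univ.filter fun a : (𝓞 K ⧸ 𝔭.asIdeal) =>
        (f.map ((Ideal.Quotient.mk 𝔭.asIdeal).comp (algebraMap ℤ (𝓞 K)))).eval a ≠ 0 ∧
          Ideal.Quotient.mk 𝔭.asIdeal (zeta3Int K ^ i) =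
            (f.map ((Ideal.Quotient.mk 𝔭.asIdeal).comp (algebraMap ℤ (𝓞 K)))).eval a ^ ((𝔭.residueCard - 1) / 3)) := by
    refine Finset.filter_congr fun a _ => ?_
    rw [hfb', hξval, ← map_pow, hq]
    exact and_congr_right fun _ => ⟨fun h => ((algebraMap (𝓞 K ⧸ 𝔭.asIdeal) (absIntegers (𝓞 K) K ⧸ 𝔓)).injective h).symm,
      fun h => congrArg (algebraMap (𝓞 K ⧸ 𝔭.asIdeal) (absIntegers (𝓞 K) K ⧸ 𝔓)) h.symm⟩
  have hfilter0 : (Finset.univ.filter fun a : (𝓞 K ⧸ 𝔭.asIdeal) => ((f.map (algebraMap ℤ (𝓞 K))).map (Ideal.Quotient.mk 𝔭.asIdeal)).eval a = 0) =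
      (Finset.univ.filter fun a : (𝓞 K ⧸ 𝔭.asIdeal) =>
        (f.map ((Ideal.Quotient.mk 𝔭.asIdeal).comp (algebraMap ℤ (𝓞 K)))).eval a = 0) := by
    rw [hfb']
  -- the character sum
  have hchar := picard_twistedCount_eq_characterSum (isPrimitiveRoot_zeta3Int K) h3𝔭 f hi
  -- assemble
  refine ⟨(Fintype.card (𝓞 K ⧸ 𝔭.asIdeal) : ℤ) + 1 -
    (Nat.card {P : PlaceOver (absIntegers (𝓞 K) K ⧸ 𝔓) (SuperellipticFunctionField (𝓞 K ⧸ 𝔭.asIdeal) (absIntegers (𝓞 K) K ⧸ 𝔓) 3 ((f.map (algebraMap ℤ (𝓞 K))).map (Ideal.Quotient.mk 𝔭.asIdeal))) // φ • (ξ • P) = P} : ℕ), ?_, ?_⟩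
  · apply IsFractionRing.injective ℤ_[3] ℚ_[3]
    rw [htransfer, hlef]
    simp only [map_sub, map_add, map_natCast, map_one, Int.cast_sub, Int.cast_add, Int.cast_natCast,
      Int.cast_one]
  · rw [hfix, hfilter, hfilter0, ← hchar]
    push_cast
    ring

include hX3 h3𝔭 hdeg𝔭 hsep𝔭 in
set_option maxHeartbeats 800000 in
/-- **`tr_{ℤ₃}(τ δ^i | T₃ J(C_f))` at a Frobenius `τ` is the twisted point count** — the theorem
`picard_trace_frob_deck` of `PicardLambdaAdicRepLocal` (there from the torsion structure `hX1`;
`picard_trace_frob_deck_of_card_deuring` from the count `hcard`) WITHOUT ANY TORSION INPUT: `T₃ J(C_f)` is free of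
finite rank because `J[1 - ω]` is finite
(`free_tateModule_of_finite_geomLambdaTorsion`), and the reduction datum, bijective on `3`-power torsion,
induces an ISOMORPHISM of Tate modules (`tateModule_map_bijective_of_forall_torsionBy`), so the ranks of the two
fibres agree whatever they are; then transfer of traces (`trace_eq_of_injective_of_comp_eq`), the twisted
Lefschetz trace formula (`hX3`), fixed places of `Frob ∘ δ̄^i` (`card_fixedPlaces_frobenius_deck`) and
cubic character sums (`picard_twistedCount_eq_characterSum`), verbatim as in `picard_trace_frob_deck_of_card_deuring`.
[cite: Upton2009, §2] [cite: Milne1986JacobianVarieties, §11 Prop. 11.2] -/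
private theorem picard_trace_frob_deck_of_bij_deuring
    (τ : absoluteGaloisGroup K) (hτ : IsArithFrobAt (𝓞 K) τ 𝔓) {i : ℕ} (hi : i < 3) :
    ∃ m : ℤ,
      LinearMap.trace ℤ_[3] _
        (DistribSMul.toLinearMap ℤ_[3] (TateModule (GeomPic K 3 (f.map (algebraMap ℤ K))) 3) τ ∘ₗ
          DistribSMul.toLinearMap ℤ_[3] (TateModule (GeomPic K 3 (f.map (algebraMap ℤ K))) 3)
            (deckGen (isPrimitiveRoot_zeta3 K) ^ i)) = m ∧
      (m : 𝓞 K) = (zeta3Int K ^ i) ^ 2 * picardTrace f 𝔭 + zeta3Int K ^ i * picardTrace (f ^ 2) 𝔭 := by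
  classical
  haveI : Fact (Nat.Prime 3) := ⟨Nat.prime_three⟩
  haveI := fact_irreducible_reduction_inst (K := K) (f := f) hdeg𝔭 hsep𝔭 (𝔓 := 𝔓)
  letI : Fintype (𝓞 K ⧸ 𝔭.asIdeal) := Fintype.ofFinite (𝓞 K ⧸ 𝔭.asIdeal)
  haveI : IsAlgClosed (absIntegers (𝓞 K) K ⧸ 𝔓) := absIntegers.isAlgClosed_quotient 𝔓
  haveI : Algebra.IsAlgebraic (𝓞 K ⧸ 𝔭.asIdeal) (absIntegers (𝓞 K) K ⧸ 𝔓) := inferInstance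
  have hfb' : ((f.map (algebraMap ℤ (𝓞 K))).map (Ideal.Quotient.mk 𝔭.asIdeal)) = f.map ((Ideal.Quotient.mk 𝔭.asIdeal).comp (algebraMap ℤ (𝓞 K))) :=
    map_map_mk_ringOfIntegers K f 𝔭
  have h3k : (3 : (𝓞 K ⧸ 𝔭.asIdeal)) ≠ 0 := three_ne_zero_residue h3𝔭
  have hq : Fintype.card (𝓞 K ⧸ 𝔭.asIdeal) = 𝔭.residueCard := by
    rw [HeightOneSpectrum.residueCard_eq_card_quotient, Nat.card_eq_fintype_card]
  have hdegb : ((f.map (algebraMap ℤ (𝓞 K))).map (Ideal.Quotient.mk 𝔭.asIdeal)).natDegree = 4 := by rw [hfb']; exact hdeg𝔭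
  have hsepb : ((f.map (algebraMap ℤ (𝓞 K))).map (Ideal.Quotient.mk 𝔭.asIdeal)).Separable := by rw [hfb']; exact hsep𝔭
  have hndvdb : ¬ 3 ∣ ((f.map (algebraMap ℤ (𝓞 K))).map (Ideal.Quotient.mk 𝔭.asIdeal)).natDegree := by rw [hdegb]; decide
  have hpq : 3 ∣ Fintype.card (𝓞 K ⧸ 𝔭.asIdeal) - 1 := by
    rw [hq]; exact three_dvd_residueCard_sub_one (isPrimitiveRoot_zeta3Int K) h3𝔭
  -- the reduction datum and ranks (special fibre count from the bijection, not from `hX1`)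
  obtain ⟨red, hredτ, hredζ, hinj, hsurj⟩ := picard_exists_reduction_bij_deuring (K := K) (f := f) h3𝔭 hdeg𝔭 hsep𝔭 (𝔓 := 𝔓)
  haveI : Module.Finite ℤ_[3] (TateModule (GeomPic K 3 (f.map (algebraMap ℤ K))) 3) := picard_finite_tateModule_inst K f
  haveI : Module.Free ℤ_[3] (TateModule (GeomPic K 3 (f.map (algebraMap ℤ K))) 3) := picard_free_tateModule_inst K f
  have hbij := tateModule_map_bijective_of_forall_torsionBy red hinj hsurj
  set ered := LinearEquiv.ofBijective (TateModule.map 3 red) hbij with hered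
  haveI : Module.Finite ℤ_[3] (TateModule (SuperellipticPic (𝓞 K ⧸ 𝔭.asIdeal) (absIntegers (𝓞 K) K ⧸ 𝔓) 3
      ((f.map (algebraMap ℤ (𝓞 K))).map (Ideal.Quotient.mk 𝔭.asIdeal))) 3) := Module.Finite.equiv ered
  haveI : Module.Free ℤ_[3] (TateModule (SuperellipticPic (𝓞 K ⧸ 𝔭.asIdeal) (absIntegers (𝓞 K) K ⧸ 𝔓) 3
      ((f.map (algebraMap ℤ (𝓞 K))).map (Ideal.Quotient.mk 𝔭.asIdeal))) 3) := Module.Free.of_equiv ered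
  have hrank : Module.finrank ℤ_[3] (TateModule (GeomPic K 3 (f.map (algebraMap ℤ K))) 3) =
      Module.finrank ℤ_[3] (TateModule (SuperellipticPic (𝓞 K ⧸ 𝔭.asIdeal) (absIntegers (𝓞 K) K ⧸ 𝔓) 3 ((f.map (algebraMap ℤ (𝓞 K))).map (Ideal.Quotient.mk 𝔭.asIdeal))) 3) :=
    ered.finrank_eq
  -- the Frobenius automorphism of `κ(𝔓)` and the reduced deck transformation
  set φ : (absIntegers (𝓞 K) K ⧸ 𝔓) ≃ₐ[(𝓞 K ⧸ 𝔭.asIdeal)] (absIntegers (𝓞 K) K ⧸ 𝔓) :=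
    Ideal.Quotient.stabilizerHom 𝔓 𝔭.asIdeal (absoluteGaloisGroup K) ⟨τ, hτ.mem_stabilizer⟩ with hφdef
  have hφ : ∀ x : (absIntegers (𝓞 K) K ⧸ 𝔓), φ x = x ^ Fintype.card (𝓞 K ⧸ 𝔭.asIdeal) := stabilizerHom_apply_eq_pow (K := K) τ hτ
  set ξ : CyclicCoverDeck (absIntegers (𝓞 K) K ⧸ 𝔓) 3 := CyclicCoverDeck.reduceMod K 3 𝔓 (deckGen (isPrimitiveRoot_zeta3 K) ^ i) with hξdef
  -- transfer of the trace to the special fibre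
  have htransfer : LinearMap.trace ℤ_[3] _
      (DistribSMul.toLinearMap ℤ_[3] (TateModule (GeomPic K 3 (f.map (algebraMap ℤ K))) 3) τ ∘ₗ
        DistribSMul.toLinearMap ℤ_[3] (TateModule (GeomPic K 3 (f.map (algebraMap ℤ K))) 3)
          (deckGen (isPrimitiveRoot_zeta3 K) ^ i)) =
      LinearMap.trace ℤ_[3] _
        (DistribSMul.toLinearMap ℤ_[3] (TateModule (SuperellipticPic (𝓞 K ⧸ 𝔭.asIdeal) (absIntegers (𝓞 K) K ⧸ 𝔓) 3 ((f.map (algebraMap ℤ (𝓞 K))).map (Ideal.Quotient.mk 𝔭.asIdeal))) 3) φ ∘ₗ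
          DistribSMul.toLinearMap ℤ_[3] (TateModule (SuperellipticPic (𝓞 K ⧸ 𝔭.asIdeal) (absIntegers (𝓞 K) K ⧸ 𝔓) 3 ((f.map (algebraMap ℤ (𝓞 K))).map (Ideal.Quotient.mk 𝔭.asIdeal))) 3) ξ) :=
    trace_eq_of_injective_of_comp_eq hrank (TateModule.map 3 red) hbij.1 _ _
      (TateModule.map_comp_toLinearMap_eq red τ φ (fun c => hredτ ⟨τ, hτ.mem_stabilizer⟩ c) _ ξ
        (fun c => hredζ _ c))
  -- twisted Lefschetz on `V₃` of the special fibre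
  have hlef := hX3 (𝓞 K ⧸ 𝔭.asIdeal) (absIntegers (𝓞 K) K ⧸ 𝔓) 3 3 ((f.map (algebraMap ℤ (𝓞 K))).map (Ideal.Quotient.mk 𝔭.asIdeal)) (by exact_mod_cast h3k) (by exact_mod_cast h3k) hsepb hndvdb φ hφ ξ
  rw [trace_rationalTateRepresentation_comp] at hlef
  -- the fixed places of `Frob ∘ δ̄^i`
  have hfix := SuperellipticFunctionField.card_fixedPlaces_frobenius_deck (k := (𝓞 K ⧸ 𝔭.asIdeal)) (Ω := (absIntegers (𝓞 K) K ⧸ 𝔓)) (p := 3) (f := ((f.map (algebraMap ℤ (𝓞 K))).map (Ideal.Quotient.mk 𝔭.asIdeal))) φ hφ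
    (by exact_mod_cast h3k) hsepb hndvdb hpq ξ
  -- the label condition in the two spellings
  have hξval : ξ.val = algebraMap (𝓞 K ⧸ 𝔭.asIdeal) (absIntegers (𝓞 K) K ⧸ 𝔓) (Ideal.Quotient.mk 𝔭.asIdeal (zeta3Int K ^ i)) :=
    val_reduceMod_deckGen_pow (K := K) (𝔓 := 𝔓) i
  have hfilter : (Finset.univ.filter fun a : (𝓞 K ⧸ 𝔭.asIdeal) => ((f.map (algebraMap ℤ (𝓞 K))).map (Ideal.Quotient.mk 𝔭.asIdeal)).eval a ≠ 0 ∧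
      algebraMap (𝓞 K ⧸ 𝔭.asIdeal) (absIntegers (𝓞 K) K ⧸ 𝔓) (((f.map (algebraMap ℤ (𝓞 K))).map (Ideal.Quotient.mk 𝔭.asIdeal)).eval a) ^ ((Fintype.card (𝓞 K ⧸ 𝔭.asIdeal) - 1) / 3) = ξ.val) =
      (Finset.univ.filter fun a : (𝓞 K ⧸ 𝔭.asIdeal) =>
        (f.map ((Ideal.Quotient.mk 𝔭.asIdeal).comp (algebraMap ℤ (𝓞 K)))).eval a ≠ 0 ∧
          Ideal.Quotient.mk 𝔭.asIdeal (zeta3Int K ^ i) =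
            (f.map ((Ideal.Quotient.mk 𝔭.asIdeal).comp (algebraMap ℤ (𝓞 K)))).eval a ^ ((𝔭.residueCard - 1) / 3)) := by
    refine Finset.filter_congr fun a _ => ?_
    rw [hfb', hξval, ← map_pow, hq]
    exact and_congr_right fun _ => ⟨fun h => ((algebraMap (𝓞 K ⧸ 𝔭.asIdeal) (absIntegers (𝓞 K) K ⧸ 𝔓)).injective h).symm,
      fun h => congrArg (algebraMap (𝓞 K ⧸ 𝔭.asIdeal) (absIntegers (𝓞 K) K ⧸ 𝔓)) h.symm⟩
  have hfilter0 : (Finset.univ.filter fun a : (𝓞 K ⧸ 𝔭.asIdeal) => ((f.map (algebraMap ℤ (𝓞 K))).map (Ideal.Quotient.mk 𝔭.asIdeal)).eval a = 0) =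
      (Finset.univ.filter fun a : (𝓞 K ⧸ 𝔭.asIdeal) =>
        (f.map ((Ideal.Quotient.mk 𝔭.asIdeal).comp (algebraMap ℤ (𝓞 K)))).eval a = 0) := by
    rw [hfb']
  -- the character sum
  have hchar := picard_twistedCount_eq_characterSum (isPrimitiveRoot_zeta3Int K) h3𝔭 f hi
  -- assemble
  refine ⟨(Fintype.card (𝓞 K ⧸ 𝔭.asIdeal) : ℤ) + 1 -
    (Nat.card {P : PlaceOver (absIntegers (𝓞 K) K ⧸ 𝔓) (SuperellipticFunctionField (𝓞 K ⧸ 𝔭.asIdeal) (absIntegers (𝓞 K) K ⧸ 𝔓) 3 ((f.map (algebraMap ℤ (𝓞 K))).map (Ideal.Quotient.mk 𝔭.asIdeal))) // φ • (ξ • P) = P} : ℕ), ?_, ?_⟩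
  · apply IsFractionRing.injective ℤ_[3] ℚ_[3]
    rw [htransfer, hlef]
    simp only [map_sub, map_add, map_natCast, map_one, Int.cast_sub, Int.cast_add, Int.cast_natCast,
      Int.cast_one]
  · rw [hfix, hfilter, hfilter0, ← hchar]
    push_cast
    ring

include hX3 h3𝔭 hdeg𝔭 hsep𝔭 in
/-- **`tr_{ℤ₃}(τ | T₃ J(C_f)) ≡ 2 (#roots of f̄ in k_𝔭) - 2 (mod 3)`** at an arithmetic Frobenius `τ` of a good
prime `𝔭 ∤ 3`: the trace is the integer `m₀` with `m₀ = a_𝔭(f) + a_𝔭(f²)` (`picard_trace_frob_deck_of_bij_deuring`,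
`i = 0`), and each cubic character sum is `≡ #{x : f̄ x = 0} - 1 (mod 1 - ζ)` (`χ ≡ 1` off the roots,
`neg_sum_cubicResidueSymbol_eval_sub_mem_span`), while `(1 - ζ) ∩ ℤ = 3ℤ`. [cite: Upton2009, §2]
[cite: IrelandRosen1982, Ch. 9 §3] -/
private theorem picard_trace_frob_congr_deuring [DecidableEq (𝓞 K ⧸ 𝔭.asIdeal)] (τ : absoluteGaloisGroup K) (hτ : IsArithFrobAt (𝓞 K) τ 𝔓) :
    ∃ m : ℤ,
      LinearMap.trace ℤ_[3] _ (DistribSMul.toLinearMap ℤ_[3] (TateModule (GeomPic K 3 (f.map (algebraMap ℤ K))) 3) τ) = m ∧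
      (3 : ℤ) ∣ m + 2 - 2 * ((f.map ((Ideal.Quotient.mk 𝔭.asIdeal).comp (algebraMap ℤ (𝓞 K)))).roots.toFinset.card : ℤ) := by
  classical
  letI : Fintype (𝓞 K ⧸ 𝔭.asIdeal) := Fintype.ofFinite (𝓞 K ⧸ 𝔭.asIdeal)
  obtain ⟨m, hm, hm'⟩ := picard_trace_frob_deck_of_bij_deuring (K := K) (f := f) hX3 h3𝔭 hdeg𝔭 hsep𝔭 (𝔓 := 𝔓) τ hτ
    (i := 0) (by norm_num)
  refine ⟨m, ?_, ?_⟩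
  · have h1 : DistribSMul.toLinearMap ℤ_[3] (TateModule (GeomPic K 3 (f.map (algebraMap ℤ K))) 3)
        (1 : CyclicCoverDeck (AlgebraicClosure K) 3) = LinearMap.id :=
      LinearMap.ext fun x => one_smul _ x
    rw [pow_zero, h1, LinearMap.comp_id] at hm
    exact hm
  · set g : (𝓞 K ⧸ 𝔭.asIdeal)[X] := f.map ((Ideal.Quotient.mk 𝔭.asIdeal).comp (algebraMap ℤ (𝓞 K))) with hg
    have hg0 : g ≠ 0 := by
      intro h0
      rw [h0, natDegree_zero] at hdeg𝔭
      exact absurd hdeg𝔭 (by norm_num)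
    have hg20 : g ^ 2 ≠ 0 := pow_ne_zero 2 hg0
    have hζ := isPrimitiveRoot_zeta3Int K
    -- the two character-sum congruences
    have hA := neg_sum_cubicResidueSymbol_eval_sub_mem_span hζ h3𝔭 hg0
    have hA' := neg_sum_cubicResidueSymbol_eval_sub_mem_span hζ h3𝔭 hg20
    have hroots : (g ^ 2).roots.toFinset = g.roots.toFinset := by
      rw [roots_pow, Multiset.toFinset_nsmul _ _ two_ne_zero]
    rw [hroots] at hA'
    have hT : picardTrace f 𝔭 = -∑ x, cubicResidueSymbol 𝔭 (g.eval x) := picardTrace_eq_neg_sum f 𝔭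
    have hT' : picardTrace (f ^ 2) 𝔭 = -∑ x, cubicResidueSymbol 𝔭 ((g ^ 2).eval x) := by
      rw [picardTrace_eq_neg_sum, Polynomial.map_pow]
    rw [pow_zero, one_pow, one_mul, one_mul, hT, hT'] at hm'
    have hsum : (m : 𝓞 K) - 2 * ((g.roots.toFinset.card : 𝓞 K) - 1) ∈ Ideal.span {1 - zeta3Int K} := by
      have h := Ideal.add_mem _ hA hA'
      rw [hm']
      convert h using 1
      ring
    refine three_dvd_of_intCast_mem_span_one_sub hζ ?_
    push_cast
    convert hsum using 1
    ring

end GoodPrime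

include hX3 in
/-- **The geometric Frobenius has trace `j(a_𝔭(f))` on `ρ = ρ₁^∨`**: for `ρ₁` built with `u = j(ω)²`,
`τ` an arithmetic Frobenius at `𝔓 ∣ 𝔭` (`𝔭 ∤ 3` of good reduction) and `ρ = ρ₁^∨` the dual,
`tr ρ(τ⁻¹) = tr ρ₁(τ) = j(a_𝔭(f))` — the FROBENIUS TRACE clause of `picardCurve_exists_lambdaAdicRep`, from
the count `hcard` instead of `hX1` (`picard_trace_frob_deck_of_card_deuring`; then the nondegenerate `2 × 2` system
`X + Y = m₀`, `uX + u²Y = m₁` against `j(a) + j(a') = m₀`, `u j(a) + u² j(a') = m₁` as in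
`trace_picardRho1_frob`). [cite: Upton2009, §2, Thm. 2.1] -/
private theorem trace_dual_picardRho1_frob_inv_of_card_deuring
    (hcard : ∀ n, Nat.card (AddSubgroup.torsionBy (GeomPic K 3 (f.map (algebraMap ℤ K))) (3 ^ n : ℕ)) = 3 ^ (2 * 3 * n))
    (b : Module.Basis (Fin 3) PadicEisenstein (TateModule (GeomPic K 3 (f.map (algebraMap ℤ K))) 3))
    (j : K →+* PadicAlgCl 3) (hu : (j (zeta3 K) ^ 2) ^ 2 + j (zeta3 K) ^ 2 + 1 = 0)
    {𝔭 : HeightOneSpectrum (𝓞 K)} (h3𝔭 : (3 : 𝓞 K) ∉ 𝔭.asIdeal)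
    (hdeg𝔭 : (f.map ((Ideal.Quotient.mk 𝔭.asIdeal).comp (algebraMap ℤ (𝓞 K)))).natDegree = 4)
    (hsep𝔭 : (f.map ((Ideal.Quotient.mk 𝔭.asIdeal).comp (algebraMap ℤ (𝓞 K)))).Separable)
    {𝔓 : Ideal (absIntegers (𝓞 K) K)} (h𝔓 : 𝔓 ∈ 𝔭.primesAbove)
    (τ : absoluteGaloisGroup K) (hτ : IsArithFrobAt (𝓞 K) τ 𝔓) :
    FramedRep.trace (FramedRep.dual (picardRho1 hcard b (j (zeta3 K) ^ 2) hu)) τ⁻¹ = j (picardTrace f 𝔭 : K) := by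
  rw [FramedRep.trace_dual, inv_inv]
  haveI := HeightOneSpectrum.isMaximal_of_mem_primesAbove h𝔓
  haveI : 𝔓.LiesOver 𝔭.asIdeal := h𝔓.2
  set v := j (zeta3 K) with hv
  set u := v ^ 2 with hudef
  have hv3 : v ^ 3 = 1 := by rw [hv, ← map_pow, (isPrimitiveRoot_zeta3 K).pow_eq_one, map_one]
  have hv1 : v ≠ 1 := by
    rw [hv, Ne, ← map_one j, j.injective.eq_iff]
    exact (isPrimitiveRoot_zeta3 K).ne_one (by norm_num)
  have hu' : (u ^ 2) ^ 2 + u ^ 2 + 1 = 0 := sq_sq_add_sq_add_one hu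
  have hu2v : u ^ 2 = v := by rw [hudef]; linear_combination v * hv3
  -- the two integers `m₀, m₁`
  obtain ⟨m₀, hm₀, hm₀'⟩ := picard_trace_frob_deck_of_card_deuring (K := K) (f := f) hX3 h3𝔭 hdeg𝔭 hsep𝔭 (𝔓 := 𝔓) hcard τ hτ
    (i := 0) (by norm_num)
  obtain ⟨m₁, hm₁, hm₁'⟩ := picard_trace_frob_deck_of_card_deuring (K := K) (f := f) hX3 h3𝔭 hdeg𝔭 hsep𝔭 (𝔓 := 𝔓) hcard τ hτ
    (i := 1) (by norm_num)
  rw [trace_frob_deck_eq_algebraTrace b τ] at hm₀ hm₁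
  rw [pow_zero, one_mul] at hm₀
  rw [pow_one] at hm₁
  -- `A = tr_O(τ | T)`, `X = σ(A)`, `Y = σ̄(A)`
  set A : PadicEisenstein := LinearMap.trace PadicEisenstein _
    (DistribMulAction.toModuleEnd PadicEisenstein (TateModule (GeomPic K 3 (f.map (algebraMap ℤ K))) 3) τ) with hA
  rw [trace_picardRho1 hcard b u hu τ]
  -- `X + Y = m₀`, `u X + u² Y = m₁`
  have e0 := lift_add_lift_sq_eq_algebraMap_trace u hu hu' A
  have e1 := lift_add_lift_sq_eq_algebraMap_trace u hu hu' (PadicEisenstein.omega * A)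
  rw [hm₀, map_intCast] at e0
  rw [hm₁, map_intCast, map_mul, map_mul, PadicEisenstein.lift_omega, PadicEisenstein.lift_omega] at e1
  -- `j a + j a' = m₀`, `v² j a + v j a' = m₁`
  set J : 𝓞 K →+* PadicAlgCl 3 := j.comp (algebraMap (𝓞 K) K) with hJ
  have hJζ : J (zeta3Int K) = v := rfl
  have e0' := congrArg J hm₀'
  have e1' := congrArg J hm₁'
  simp only [pow_zero, one_pow, one_mul, pow_one, map_add, map_mul, map_pow, map_intCast, hJζ] at e0' e1'
  change PadicEisenstein.lift u hu A = J (picardTrace f 𝔭)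
  -- solve the `2 × 2` system
  have hv0 : v ≠ 0 := by
    rintro h0; rw [h0] at hv3; norm_num at hv3
  have hvv : v ^ 2 - v ≠ 0 := by
    rw [show v ^ 2 - v = v * (v - 1) by ring]
    exact mul_ne_zero hv0 (sub_ne_zero.2 hv1)
  have key : (v ^ 2 - v) * (PadicEisenstein.lift u hu A - J (picardTrace f 𝔭)) = 0 := by
    linear_combination e1 + e1' - v * (e0 + e0') - (PadicEisenstein.lift u hu A) * hudef -
      (PadicEisenstein.lift (u ^ 2) hu' A) * hu2v
  exact sub_eq_zero.1 ((mul_eq_zero.1 key).resolve_left hvv)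

include hX3 in
/-- **The rank dichotomy: `rank_{ℤ₃} T₃ J(C_f) ∈ {0, 6}`** (given the good-reduction datum and the twisted
Lefschetz formula, WITHOUT any torsion count or divisibility input).  Write `s = rank T = 2r` with
`[T : λT] = 3^r ≤ #J[1 - ω] = 27` (`exists_finrank_eq_two_mul`), so `r ≤ 3`.  Take (Chebotarev, `g = 1`) a good
place `𝔭 ∤ 3` whose Frobenius `Φ` fixes every root of `f`: then `f mod 𝔭` has `4` roots in `k_𝔭`, so
`tr(Φ | T) = m ≡ 2 · 4 - 2 ≡ 0 (mod 3)` (`picard_trace_frob_congr_deuring`); and `Φ` is trivial on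
`J[1 - ω] ≅ (𝔽₃^{roots})⁰` (`picard_smul_geomLambdaTorsion_eq_of_forall_smul_rootSet_eq`), so
`m ≡ s (mod 3)` (`picard_three_dvd_trace_sub_finrank`).  Hence `3 ∣ r`, `r ∈ {0, 3}`.
[cite: Upton2009, §2] [cite: SerreAbelianLadic1968, Ch. I §1.1] [cite: NeukirchANT1999, VII Thm. (13.4)] -/
private theorem picard_finrank_tateModule_eq_zero_or_eq_six_deuring :
    Module.finrank ℤ_[3] (TateModule (GeomPic K 3 (f.map (algebraMap ℤ K))) 3) = 0 ∨
      Module.finrank ℤ_[3] (TateModule (GeomPic K 3 (f.map (algebraMap ℤ K))) 3) = 6 := by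
  classical
  haveI := picard_finite_geomLambdaTorsion_inst K f
  have hζ := isPrimitiveRoot_zeta3 K
  have hsep' := separable_map_algebraMap_int K hfs.out
  have hndvd := not_three_dvd_natDegree_map K hf4.out
  obtain ⟨r, hr, -, hle⟩ := exists_finrank_eq_two_mul hζ hsep' hndvd
  rw [picard_card_geomLambdaTorsion K f hf4.out hfs.out] at hle
  have hr3 : r ≤ 3 := by
    by_contra h
    have h4r : 3 ^ 4 ≤ 3 ^ r := Nat.pow_le_pow_right (by norm_num) (by omega)
    exact absurd (le_trans h4r hle) (by norm_num)
  obtain ⟨𝔭, 𝔓, Φ, h3𝔭, hdeg𝔭, hsep𝔭, h𝔓, hΦ, hsmul⟩ :=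
    picard_exists_goodPlace_frob_smul_rootSet_eq (K := K) (f := f) 1
  haveI := HeightOneSpectrum.isMaximal_of_mem_primesAbove h𝔓
  haveI : 𝔓.LiesOver 𝔭.asIdeal := h𝔓.2
  have hfix : ∀ x : (f.map (algebraMap ℤ K)).rootSet (AlgebraicClosure K), Φ • x = x := fun x => by
    rw [hsmul, one_smul]
  obtain ⟨m, hm, hdvd⟩ := picard_trace_frob_congr_deuring (K := K) (f := f) hX3 h3𝔭 hdeg𝔭 hsep𝔭 (𝔓 := 𝔓) Φ hΦ
  rw [roots_toFinset_card_eq_four_of_forall_smul_eq f hf4.out hfs.out hdeg𝔭 hsep𝔭 h𝔓 hΦ hfix] at hdvd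
  have hdvd' := picard_three_dvd_trace_sub_finrank (K := K) (f := f) Φ
    (picard_smul_geomLambdaTorsion_eq_of_forall_smul_rootSet_eq K f hf4.out hfs.out Φ hfix) hm
  rw [hr] at hdvd' ⊢
  push_cast at hdvd hdvd'
  omega

include hX3 in
/-- **Rank `6` from `T ≠ 0`** (the dichotomy). [cite: Upton2009, §2] -/
private theorem picard_finrank_tateModule_eq_six_of_nontrivial_deuring
    [Nontrivial (TateModule (GeomPic K 3 (f.map (algebraMap ℤ K))) 3)] :
    Module.finrank ℤ_[3] (TateModule (GeomPic K 3 (f.map (algebraMap ℤ K))) 3) = 6 := by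
  refine (picard_finrank_tateModule_eq_zero_or_eq_six_deuring (K := K) (f := f) hX3).resolve_left fun h0 => ?_
  haveI := picard_finite_tateModule_inst K f
  haveI := picard_free_tateModule_inst K f
  haveI := subsingleton_of_finrank_eq_zero h0
  exact false_of_nontrivial_of_subsingleton (TateModule (GeomPic K 3 (f.map (algebraMap ℤ K))) 3)

include hX3 in
/-- **The `λ`-adic representation of one Picard curve of rank `6`.**  For `f` with
`rank_{ℤ₃} T₃ J(C_f) = 6` (so `#J_f[3ⁿ] = 3^{6n}`, `picard_hcard_of_finrank_eq_six`) and an embedding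
`j : K → ℚ̄₃`, the dual `ρ = ρ₁^∨` of the representation `ρ₁` on `T ⊗_{ℤ₃[ω], j} ℤ̄₃` in the basis of
`picard_exists_basis_repr_smul_congr` is unramified at the good places `𝔭 ∤ 3`, has
`tr ρ(Frob_𝔭⁻¹) = j(a_𝔭(f))` there, and is absolutely irreducible when `12 ∣ #Gal(f/ℚ)` — the three clauses of
`picardCurve_exists_lambdaAdicRep` for this `f` (same assembly as
`picardCurve_exists_lambdaAdicRep_of_card_goodReduction_lefschetz`). [cite: Upton2009, Thm. 2.1 and §4] -/
private theorem picard_exists_framedGaloisRep_of_finrank_eq_six_deuring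
    (h6 : Module.finrank ℤ_[3] (TateModule (GeomPic K 3 (f.map (algebraMap ℤ K))) 3) = 6)
    (j : K →+* PadicAlgCl 3) :
    ∃ ρ : FramedGaloisRep K (PadicAlgCl 3) 3,
      (∀ 𝔭 : HeightOneSpectrum (𝓞 K), (3 : 𝓞 K) ∉ 𝔭.asIdeal →
        (f.map ((Ideal.Quotient.mk 𝔭.asIdeal).comp (algebraMap ℤ (𝓞 K)))).natDegree = 4 →
        (f.map ((Ideal.Quotient.mk 𝔭.asIdeal).comp (algebraMap ℤ (𝓞 K)))).Separable →
          ρ.IsUnramifiedAt 𝔭 ∧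
          ∀ 𝔓 ∈ 𝔭.primesAbove, ∀ τ : absoluteGaloisGroup K, IsArithFrobAt (𝓞 K) τ 𝔓 →
            FramedRep.trace ρ τ⁻¹ = j (picardTrace f 𝔭 : K)) ∧
      (12 ∣ Nat.card (f.map (Int.castRingHom ℚ)).Gal → FramedRep.IsAbsolutelyIrreducible ρ) := by
  classical
  have hcard := picard_hcard_of_finrank_eq_six (K := K) (f := f) h6
  obtain ⟨r₀, b, hb⟩ := picard_exists_basis_repr_smul_congr K f hf4.out hfs.out (isPrimitiveRoot_zeta3 K) hcard
  have hR4 : Fintype.card ((f.map (algebraMap ℤ K)).rootSet (AlgebraicClosure K)) = 4 :=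
    card_rootSet_map_algebraMap_int K hf4.out hfs.out
  have hι : Fintype.card {y : (f.map (algebraMap ℤ K)).rootSet (AlgebraicClosure K) // y ≠ r₀} = 3 := by
    rw [Fintype.card_subtype_compl, hR4, Fintype.card_subtype_eq]
  set e := Fintype.equivFinOfCardEq hι with he
  -- `u = j(ω)²`, the other primitive cube root of unity of `ℚ̄₃`
  have hv : j (zeta3 K) ^ 2 + j (zeta3 K) + 1 = 0 := by
    set v := j (zeta3 K) with hvdef
    have hv3 : v ^ 3 = 1 := by
      rw [hvdef, ← map_pow, (isPrimitiveRoot_zeta3 K).pow_eq_one, map_one]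
    have hv1 : v ≠ 1 := by
      rw [hvdef, Ne, ← map_one j, j.injective.eq_iff]
      exact (isPrimitiveRoot_zeta3 K).ne_one (by norm_num)
    have h : (v - 1) * (v ^ 2 + v + 1) = 0 := by linear_combination hv3
    rcases mul_eq_zero.1 h with h | h
    · exact absurd (sub_eq_zero.1 h) hv1
    · exact h
  have hu : (j (zeta3 K) ^ 2) ^ 2 + j (zeta3 K) ^ 2 + 1 = 0 := sq_sq_add_sq_add_one hv
  refine ⟨FramedRep.dual (picardRho1 hcard (b.reindex e) (j (zeta3 K) ^ 2) hu), ?_, ?_⟩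
  · intro 𝔭 h3 hdeg𝔭 hsep𝔭
    refine ⟨(FramedGaloisRep.isUnramifiedAt_dual_iff 𝔭 _).2
      (picardRho1_isUnramifiedAt_deuring (K := K) (f := f) h3 hdeg𝔭 hsep𝔭 hcard _ _ hu), ?_⟩
    intro 𝔓 h𝔓 τ hτ
    exact trace_dual_picardRho1_frob_inv_of_card_deuring (K := K) (f := f) hX3 hcard _ j hu h3 hdeg𝔭 hsep𝔭 h𝔓 τ hτ
  · intro h12
    exact (picardRho1_isAbsolutelyIrreducible (K := K) (f := f) hcard h12 e b hb _ hu).dual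

include hX3 in
/-- **`T₃ J(C_f) ≠ 0` for every Picard quartic over a number field `K ⊇ ℚ(ω)`** — the residual input `hX0` of
`picardCurve_exists_lambdaAdicRep_of_nontrivial_goodReduction_lefschetz`, now PROVED from `hX3` (the good-reduction datum being a theorem): at a
good place `𝔭 ∤ 3` (Chebotarev, `picard_exists_goodPlace_frob_smul_rootSet_eq`, merely to have one) the
reduction map (`picard_exists_reduction_bij_deuring`) is bijective on `3`-power torsion, hence an isomorphism of Tate modules
(`tateModule_map_bijective_of_forall_torsionBy`), and the Tate module of the special fibre `Pic(C_{f̄, κ(𝔓)})`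
is nonzero (`nontrivial_tateModule_superellipticPic_of_lefschetz`: twisted Lefschetz + Hasse–Weil).
[cite: Upton2009, §2] [cite: SerreTate1968GoodReduction, §1, Thm. 1] [cite: Stichtenoth2009, Thm. 5.2.1] -/
private theorem picard_nontrivial_tateModule_deuring : Nontrivial (TateModule (GeomPic K 3 (f.map (algebraMap ℤ K))) 3) := by
  obtain ⟨𝔭, 𝔓, Φ, h3𝔭, hdeg𝔭, hsep𝔭, h𝔓, hΦ, -⟩ :=
    picard_exists_goodPlace_frob_smul_rootSet_eq (K := K) (f := f) 1
  haveI := HeightOneSpectrum.isMaximal_of_mem_primesAbove h𝔓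
  haveI : 𝔓.LiesOver 𝔭.asIdeal := h𝔓.2
  haveI : Fact (Nat.Prime 3) := ⟨Nat.prime_three⟩
  haveI := fact_irreducible_reduction_inst (K := K) (f := f) hdeg𝔭 hsep𝔭 (𝔓 := 𝔓)
  letI : Fintype (𝓞 K ⧸ 𝔭.asIdeal) := Fintype.ofFinite (𝓞 K ⧸ 𝔭.asIdeal)
  haveI : IsAlgClosed (absIntegers (𝓞 K) K ⧸ 𝔓) := absIntegers.isAlgClosed_quotient 𝔓
  haveI : Algebra.IsAlgebraic (𝓞 K ⧸ 𝔭.asIdeal) (absIntegers (𝓞 K) K ⧸ 𝔓) := inferInstance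
  have hfb' : ((f.map (algebraMap ℤ (𝓞 K))).map (Ideal.Quotient.mk 𝔭.asIdeal)) =
      f.map ((Ideal.Quotient.mk 𝔭.asIdeal).comp (algebraMap ℤ (𝓞 K))) := map_map_mk_ringOfIntegers K f 𝔭
  have h3k : (3 : (𝓞 K ⧸ 𝔭.asIdeal)) ≠ 0 := three_ne_zero_residue h3𝔭
  have hq : Fintype.card (𝓞 K ⧸ 𝔭.asIdeal) = 𝔭.residueCard := by
    rw [HeightOneSpectrum.residueCard_eq_card_quotient, Nat.card_eq_fintype_card]
  have hdegb : ((f.map (algebraMap ℤ (𝓞 K))).map (Ideal.Quotient.mk 𝔭.asIdeal)).natDegree = 4 := by rw [hfb']; exact hdeg𝔭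
  have hsepb : ((f.map (algebraMap ℤ (𝓞 K))).map (Ideal.Quotient.mk 𝔭.asIdeal)).Separable := by rw [hfb']; exact hsep𝔭
  have hpq : 3 ∣ Fintype.card (𝓞 K ⧸ 𝔭.asIdeal) - 1 := by
    rw [hq]; exact three_dvd_residueCard_sub_one (isPrimitiveRoot_zeta3Int K) h3𝔭
  -- the reduction isomorphism of Tate modules
  obtain ⟨red, -, -, hinj, hsurj⟩ := picard_exists_reduction_bij_deuring (K := K) (f := f) h3𝔭 hdeg𝔭 hsep𝔭 (𝔓 := 𝔓)
  have hbij := tateModule_map_bijective_of_forall_torsionBy red hinj hsurj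
  -- the Frobenius of `κ(𝔓)` and the special fibre
  set φ : (absIntegers (𝓞 K) K ⧸ 𝔓) ≃ₐ[(𝓞 K ⧸ 𝔭.asIdeal)] (absIntegers (𝓞 K) K ⧸ 𝔓) :=
    Ideal.Quotient.stabilizerHom 𝔓 𝔭.asIdeal (absoluteGaloisGroup K) ⟨Φ, hΦ.mem_stabilizer⟩ with hφdef
  have hφ : ∀ x : (absIntegers (𝓞 K) K ⧸ 𝔓), φ x = x ^ Fintype.card (𝓞 K ⧸ 𝔭.asIdeal) :=
    stabilizerHom_apply_eq_pow (K := K) Φ hΦ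
  haveI := nontrivial_tateModule_superellipticPic_of_lefschetz hX3 (k := 𝓞 K ⧸ 𝔭.asIdeal)
    (Ω := absIntegers (𝓞 K) K ⧸ 𝔓) (f := (f.map (algebraMap ℤ (𝓞 K))).map (Ideal.Quotient.mk 𝔭.asIdeal))
    h3k hsepb hdegb hpq φ hφ
  exact hbij.2.nontrivial

end PicardLocal

attribute [local instance] fact_irreducible_picard_inst picardEisensteinModule picard_isScalarTower_inst
  picard_smulCommClass_inst

/-- **Galois representations attached to Picard curves** (Upton 2009, Thm. 2.1 / §4), conditional form
with the geometric input on the Tate module cut down to NON-VANISHING and the good-reduction datum `hX2` of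
`picardCurve_exists_lambdaAdicRep_of_nontrivial_goodReduction_lefschetz` PROVED: GIVEN (`hX0`) that
`T₃ Pic(C_{f,K̄}) ≠ 0` for the Picard quartics over `K ⊇ ℚ(ω)` (a shadow of `T₃ J ≅ ℤ₃⁶`, Weil/Mumford;
implied by the divisibility input `hX1'` of
`picardCurve_exists_lambdaAdicRep_of_divisible_goodReduction_lefschetz` and needed only for the `f`
whose Galois group over `ℚ(ω)` fixes a root, cf.
`picardCurve_lambdaAdicRep_of_goodReduction_lefschetz_of_twelve_dvd`), (`hX2`) the good-reduction
datum (Serre–Tate §1 Thm. 1) and (`hX3`) the twisted Lefschetz trace formula (Milne JV Prop. 11.2), the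
statement `picardCurve_exists_lambdaAdicRep` holds: the rank dichotomy
`picard_finrank_tateModule_eq_zero_or_eq_six_deuring` (Chebotarev at a totally split good prime) upgrades
`T ≠ 0` to rank `6`, i.e. to the torsion count `#J_f[3ⁿ] = 3^{6n}` of
`picardCurve_exists_lambdaAdicRep_of_card_goodReduction_lefschetz`.
[cite: Upton2009, Thm. 2.1 and §4] [cite: SerreTate1968GoodReduction, §1, Thm. 1]
[cite: Milne1986JacobianVarieties, §11 Prop. 11.2] [cite: MumfordAV1970, §6 Application 2]
[cite: NeukirchANT1999, VII Thm. (13.4)] -/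
theorem picardCurve_exists_lambdaAdicRep_of_nontrivial_lefschetz
    (hX0 : ∀ (K : Type) [Field K] [NumberField K] [IsCyclotomicExtension {3} ℚ K]
      (f : ℤ[X]) (h4 : f.natDegree = 4) (hsep : (f.map (Int.castRingHom ℚ)).Separable),
      haveI := fact_irreducible_superellipticPoly_picard K h4 hsep
      Nontrivial (TateModule (GeomPic K 3 (f.map (algebraMap ℤ K))) 3))
    (hX3 : ∀ (k : Type) [Field k] [Fintype k] (Ω : Type) [Field Ω] [Algebra k Ω] [IsAlgClosed Ω]
      [Algebra.IsAlgebraic k Ω] (p : ℕ) [Fact p.Prime] (ℓ : ℕ) [Fact ℓ.Prime] (f : k[X]),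
      (p : k) ≠ 0 → (ℓ : k) ≠ 0 → f.Separable → ¬ p ∣ f.natDegree →
      ∀ [Fact (Irreducible (superellipticPoly k Ω p f))] (φ : Ω ≃ₐ[k] Ω), (∀ x : Ω, φ x = x ^ Fintype.card k) →
      ∀ (ξ : CyclicCoverDeck Ω p),
        LinearMap.trace ℚ_[ℓ] (RationalTateModule (SuperellipticPic k Ω p f) ℓ)
          (rationalTateRepresentation (Ω ≃ₐ[k] Ω) (SuperellipticPic k Ω p f) ℓ φ ∘ₗ
            rationalTateRepresentation (CyclicCoverDeck Ω p) (SuperellipticPic k Ω p f) ℓ ξ) =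
          (Fintype.card k : ℚ_[ℓ]) + 1 -
            Nat.card {P : PlaceOver Ω (SuperellipticFunctionField k Ω p f) // φ • (ξ • P) = P}) :
    picardCurve_exists_lambdaAdicRep := by
  intro f h4 hsep j
  classical
  haveI : IsCyclotomicExtension {3} ℚ (CyclotomicField 3 ℚ) := CyclotomicField.isCyclotomicExtension 3 ℚ
  haveI hf4 : Fact (f.natDegree = 4) := ⟨h4⟩
  haveI hfs : Fact (f.map (Int.castRingHom ℚ)).Separable := ⟨hsep⟩
  haveI := hX0 (CyclotomicField 3 ℚ) f h4 hsep
  exact picard_exists_framedGaloisRep_of_finrank_eq_six_deuring (K := CyclotomicField 3 ℚ) (f := f) hX3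
    (picard_finrank_tateModule_eq_six_of_nontrivial_deuring (K := CyclotomicField 3 ℚ) (f := f) hX3) j

/-- **Galois representations attached to Picard curves** (Upton 2009, Thm. 2.1 / §4) from ONE classical input
on Jacobians: GIVEN (`hX3`) the twisted Lefschetz trace formula on `V_ℓ` of `Pic` of `y^p = f(x)` over
finite fields (Milne JV §11 Prop. 11.2; Weil), the statement `picardCurve_exists_lambdaAdicRep` holds for EVERY
quartic `f ∈ ℤ[X]` separable over `ℚ` — existence of `ρ : Γ_{ℚ(ω)} → GL₃(ℚ̄₃)` unramified outside `3N` with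
`tr ρ(Frob_𝔭⁻¹) = j(a_𝔭(f))`, and absolute irreducibility when `12 ∣ #Gal(f/ℚ)`.  The torsion/divisibility/
non-vanishing input on `T₃ J(C_f)` of the earlier conditional theorems (`hX1`, `hX1'`, `hcard`, `hX0`: forms of
`dim J(C_f) = 3`) is replaced by the Hasse–Weil theorem for function fields, which is proved in the tree
(`picard_nontrivial_tateModule_deuring`); the good-reduction datum (`hX2` of
`picardCurve_exists_lambdaAdicRep_of_goodReduction_lefschetz`) is Deuring's explicit reduction
(`superelliptic_three_exists_reduction`).
[cite: Upton2009, Thm. 2.1 and §4] [cite: SerreTate1968GoodReduction, §1, Thm. 1]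
[cite: Milne1986JacobianVarieties, §11 Prop. 11.2] [cite: Stichtenoth2009, Thm. 5.2.1] [cite: Weil1948] -/
theorem picardCurve_exists_lambdaAdicRep_of_lefschetz
    (hX3 : ∀ (k : Type) [Field k] [Fintype k] (Ω : Type) [Field Ω] [Algebra k Ω] [IsAlgClosed Ω]
      [Algebra.IsAlgebraic k Ω] (p : ℕ) [Fact p.Prime] (ℓ : ℕ) [Fact ℓ.Prime] (f : k[X]),
      (p : k) ≠ 0 → (ℓ : k) ≠ 0 → f.Separable → ¬ p ∣ f.natDegree →
      ∀ [Fact (Irreducible (superellipticPoly k Ω p f))] (φ : Ω ≃ₐ[k] Ω), (∀ x : Ω, φ x = x ^ Fintype.card k) →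
      ∀ (ξ : CyclicCoverDeck Ω p),
        LinearMap.trace ℚ_[ℓ] (RationalTateModule (SuperellipticPic k Ω p f) ℓ)
          (rationalTateRepresentation (Ω ≃ₐ[k] Ω) (SuperellipticPic k Ω p f) ℓ φ ∘ₗ
            rationalTateRepresentation (CyclicCoverDeck Ω p) (SuperellipticPic k Ω p f) ℓ ξ) =
          (Fintype.card k : ℚ_[ℓ]) + 1 -
            Nat.card {P : PlaceOver Ω (SuperellipticFunctionField k Ω p f) // φ • (ξ • P) = P}) :
    picardCurve_exists_lambdaAdicRep :=
  picardCurve_exists_lambdaAdicRep_of_nontrivial_lefschetz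
    (fun K _ _ _ f h4 hsep => by
      haveI : Fact (f.natDegree = 4) := ⟨h4⟩
      haveI : Fact (f.map (Int.castRingHom ℚ)).Separable := ⟨hsep⟩
      exact picard_nontrivial_tateModule_deuring (K := K) (f := f) hX3)
    hX3

/-- **Galois representations attached to Picard curves from Weil's trace formula alone.**  ALL clauses of
`picardCurve_exists_lambdaAdicRep` (Upton 2009, Thm. 2.1 / §4), for every separable quartic `f ∈ ℤ[X]`, from the
UNTWISTED trace formula `hW` (Milne, *Jacobian varieties*, Thm. 11.1 verbatim for the curves `y^p = f(x)` over finite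
fields: `Tr(Frob | V_ℓ Pic) = q + 1 - #{places fixed by Frob}`): the twisted formula is
`superelliptic_lefschetz_twisted_of_weil hW`, the good-reduction datum is Deuring's explicit reduction
(`superelliptic_three_exists_reduction`), the rest is `picardCurve_exists_lambdaAdicRep_of_lefschetz`.
[cite: Upton2009, Thm. 2.1 and §4] [cite: Milne1986JacobianVarieties, Thm. 11.1] [cite: Deuring1942Reduktion, §4] -/
theorem picardCurve_exists_lambdaAdicRep_of_weil
    (hW : ∀ (k : Type) [Field k] [Fintype k] (Ω : Type) [Field Ω] [Algebra k Ω] [IsAlgClosed Ω]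
      [Algebra.IsAlgebraic k Ω] (p : ℕ) [Fact p.Prime] (ℓ : ℕ) [Fact ℓ.Prime] (f : k[X]),
      (p : k) ≠ 0 → (ℓ : k) ≠ 0 → f.Separable → ¬ p ∣ f.natDegree →
      ∀ [Fact (Irreducible (superellipticPoly k Ω p f))] (φ : Ω ≃ₐ[k] Ω), (∀ x : Ω, φ x = x ^ Fintype.card k) →
        LinearMap.trace ℚ_[ℓ] (RationalTateModule (SuperellipticPic k Ω p f) ℓ)
          (rationalTateRepresentation (Ω ≃ₐ[k] Ω) (SuperellipticPic k Ω p f) ℓ φ) =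
          (Fintype.card k : ℚ_[ℓ]) + 1 -
            Nat.card {P : PlaceOver Ω (SuperellipticFunctionField k Ω p f) // φ • P = P}) :
    picardCurve_exists_lambdaAdicRep :=
  picardCurve_exists_lambdaAdicRep_of_lefschetz (superelliptic_lefschetz_twisted_of_weil hW)


/-! ### Public forms of the unconditional local theory (for the de Rham companion file)

The lemmas above that carry the witness `ρ = ρ₁^∨` through the good-reduction analysis are `private` (they
shadow the conditional statements of `PicardLambdaAdicRepLocal` / `…Divisible` / `…Chebotarev` / `…Weil`, whose
`hX2` they discharge).  The companion file `PicardLambdaAdicRepDeRham` (the de Rham clause of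
`picardCurve_exists_lambdaAdicRep_isDeRhamFramed` for THIS witness) needs four of them by name; they are
re-exported here unchanged (no new statement content). -/

section PublicDeuring

variable (K : Type) [Field K] [NumberField K] [IsCyclotomicExtension {3} ℚ K]
variable (f : ℤ[X]) [hf4 : Fact (f.natDegree = 4)] [hfs : Fact (f.map (Int.castRingHom ℚ)).Separable]

attribute [local instance] fact_irreducible_picard_inst picardEisensteinModule picard_isScalarTower_inst
  picard_smulCommClass_inst

variable {K f}

/-- **`ρ₁` is unramified at a prime `𝔭 ∤ 3` of good reduction**, unconditionally (public form of
`picardRho1_isUnramifiedAt_deuring`: Deuring's reduction datum + Serre–Tate Thm. 1, easy direction).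
[cite: SerreTate1968GoodReduction, §1, Thm. 1] [cite: Deuring1942Reduktion, §4] [cite: Upton2009, §2] -/
theorem picardRho1_isUnramifiedAt_deuringDatum {𝔭 : HeightOneSpectrum (𝓞 K)} (h3𝔭 : (3 : 𝓞 K) ∉ 𝔭.asIdeal)
    (hdeg𝔭 : (f.map ((Ideal.Quotient.mk 𝔭.asIdeal).comp (algebraMap ℤ (𝓞 K)))).natDegree = 4)
    (hsep𝔭 : (f.map ((Ideal.Quotient.mk 𝔭.asIdeal).comp (algebraMap ℤ (𝓞 K)))).Separable)
    (hcard : ∀ n, Nat.card (AddSubgroup.torsionBy (GeomPic K 3 (f.map (algebraMap ℤ K))) (3 ^ n : ℕ)) = 3 ^ (2 * 3 * n))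
    (b : Module.Basis (Fin 3) PadicEisenstein (TateModule (GeomPic K 3 (f.map (algebraMap ℤ K))) 3))
    (u : PadicAlgCl 3) (hu : u ^ 2 + u + 1 = 0) :
    (picardRho1 hcard b u hu).IsUnramifiedAt 𝔭 :=
  picardRho1_isUnramifiedAt_deuring (K := K) (f := f) h3𝔭 hdeg𝔭 hsep𝔭 hcard b u hu

/-- **The geometric Frobenius has trace `j(a_𝔭(f))` on `ρ = ρ₁^∨`**, from the twisted Lefschetz formula
`hX3` and the count `hcard` alone (public form of `trace_dual_picardRho1_frob_inv_of_card_deuring`; the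
good-reduction datum is Deuring's theorem). [cite: Upton2009, §2, Thm. 2.1] [cite: Milne1986JacobianVarieties, §11 Prop. 11.2] -/
theorem trace_dual_picardRho1_frob_inv_of_card_deuringDatum
    (hX3 : ∀ (k : Type) [Field k] [Fintype k] (Ω : Type) [Field Ω] [Algebra k Ω] [IsAlgClosed Ω]
      [Algebra.IsAlgebraic k Ω] (p : ℕ) [Fact p.Prime] (ℓ : ℕ) [Fact ℓ.Prime] (f : k[X]),
      (p : k) ≠ 0 → (ℓ : k) ≠ 0 → f.Separable → ¬ p ∣ f.natDegree →
      ∀ [Fact (Irreducible (superellipticPoly k Ω p f))] (φ : Ω ≃ₐ[k] Ω), (∀ x : Ω, φ x = x ^ Fintype.card k) →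
      ∀ (ξ : CyclicCoverDeck Ω p),
        LinearMap.trace ℚ_[ℓ] (RationalTateModule (SuperellipticPic k Ω p f) ℓ)
          (rationalTateRepresentation (Ω ≃ₐ[k] Ω) (SuperellipticPic k Ω p f) ℓ φ ∘ₗ
            rationalTateRepresentation (CyclicCoverDeck Ω p) (SuperellipticPic k Ω p f) ℓ ξ) =
          (Fintype.card k : ℚ_[ℓ]) + 1 -
            Nat.card {P : PlaceOver Ω (SuperellipticFunctionField k Ω p f) // φ • (ξ • P) = P})
    (hcard : ∀ n, Nat.card (AddSubgroup.torsionBy (GeomPic K 3 (f.map (algebraMap ℤ K))) (3 ^ n : ℕ)) = 3 ^ (2 * 3 * n))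
    (b : Module.Basis (Fin 3) PadicEisenstein (TateModule (GeomPic K 3 (f.map (algebraMap ℤ K))) 3))
    (j : K →+* PadicAlgCl 3) (hu : (j (zeta3 K) ^ 2) ^ 2 + j (zeta3 K) ^ 2 + 1 = 0)
    {𝔭 : HeightOneSpectrum (𝓞 K)} (h3𝔭 : (3 : 𝓞 K) ∉ 𝔭.asIdeal)
    (hdeg𝔭 : (f.map ((Ideal.Quotient.mk 𝔭.asIdeal).comp (algebraMap ℤ (𝓞 K)))).natDegree = 4)
    (hsep𝔭 : (f.map ((Ideal.Quotient.mk 𝔭.asIdeal).comp (algebraMap ℤ (𝓞 K)))).Separable)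
    {𝔓 : Ideal (absIntegers (𝓞 K) K)} (h𝔓 : 𝔓 ∈ 𝔭.primesAbove)
    (τ : absoluteGaloisGroup K) (hτ : IsArithFrobAt (𝓞 K) τ 𝔓) :
    FramedRep.trace (FramedRep.dual (picardRho1 hcard b (j (zeta3 K) ^ 2) hu)) τ⁻¹ = j (picardTrace f 𝔭 : K) :=
  trace_dual_picardRho1_frob_inv_of_card_deuring (K := K) (f := f) hX3 hcard b j hu h3𝔭 hdeg𝔭 hsep𝔭 h𝔓 τ hτ

/-- **`T₃ J(C_f) ≠ 0` for every Picard quartic over a number field `K ⊇ ℚ(ω)`**, from the twisted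
Lefschetz formula alone (public form of `picard_nontrivial_tateModule_deuring`).
[cite: Upton2009, §2] [cite: SerreTate1968GoodReduction, §1, Thm. 1] [cite: Stichtenoth2009, Thm. 5.2.1] -/
theorem picard_nontrivial_tateModule_deuringDatum
    (hX3 : ∀ (k : Type) [Field k] [Fintype k] (Ω : Type) [Field Ω] [Algebra k Ω] [IsAlgClosed Ω]
      [Algebra.IsAlgebraic k Ω] (p : ℕ) [Fact p.Prime] (ℓ : ℕ) [Fact ℓ.Prime] (f : k[X]),
      (p : k) ≠ 0 → (ℓ : k) ≠ 0 → f.Separable → ¬ p ∣ f.natDegree →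
      ∀ [Fact (Irreducible (superellipticPoly k Ω p f))] (φ : Ω ≃ₐ[k] Ω), (∀ x : Ω, φ x = x ^ Fintype.card k) →
      ∀ (ξ : CyclicCoverDeck Ω p),
        LinearMap.trace ℚ_[ℓ] (RationalTateModule (SuperellipticPic k Ω p f) ℓ)
          (rationalTateRepresentation (Ω ≃ₐ[k] Ω) (SuperellipticPic k Ω p f) ℓ φ ∘ₗ
            rationalTateRepresentation (CyclicCoverDeck Ω p) (SuperellipticPic k Ω p f) ℓ ξ) =
          (Fintype.card k : ℚ_[ℓ]) + 1 -
            Nat.card {P : PlaceOver Ω (SuperellipticFunctionField k Ω p f) // φ • (ξ • P) = P}) :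
    Nontrivial (TateModule (GeomPic K 3 (f.map (algebraMap ℤ K))) 3) :=
  picard_nontrivial_tateModule_deuring (K := K) (f := f) hX3

/-- **Rank `6` from `T ≠ 0`**, from the twisted Lefschetz formula alone (public form of
`picard_finrank_tateModule_eq_six_of_nontrivial_deuring`). [cite: Upton2009, §2] -/
theorem picard_finrank_tateModule_eq_six_of_nontrivial_deuringDatum
    (hX3 : ∀ (k : Type) [Field k] [Fintype k] (Ω : Type) [Field Ω] [Algebra k Ω] [IsAlgClosed Ω]
      [Algebra.IsAlgebraic k Ω] (p : ℕ) [Fact p.Prime] (ℓ : ℕ) [Fact ℓ.Prime] (f : k[X]),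
      (p : k) ≠ 0 → (ℓ : k) ≠ 0 → f.Separable → ¬ p ∣ f.natDegree →
      ∀ [Fact (Irreducible (superellipticPoly k Ω p f))] (φ : Ω ≃ₐ[k] Ω), (∀ x : Ω, φ x = x ^ Fintype.card k) →
      ∀ (ξ : CyclicCoverDeck Ω p),
        LinearMap.trace ℚ_[ℓ] (RationalTateModule (SuperellipticPic k Ω p f) ℓ)
          (rationalTateRepresentation (Ω ≃ₐ[k] Ω) (SuperellipticPic k Ω p f) ℓ φ ∘ₗ
            rationalTateRepresentation (CyclicCoverDeck Ω p) (SuperellipticPic k Ω p f) ℓ ξ) =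
          (Fintype.card k : ℚ_[ℓ]) + 1 -
            Nat.card {P : PlaceOver Ω (SuperellipticFunctionField k Ω p f) // φ • (ξ • P) = P})
    [Nontrivial (TateModule (GeomPic K 3 (f.map (algebraMap ℤ K))) 3)] :
    Module.finrank ℤ_[3] (TateModule (GeomPic K 3 (f.map (algebraMap ℤ K))) 3) = 6 :=
  picard_finrank_tateModule_eq_six_of_nontrivial_deuring (K := K) (f := f) hX3

/-- **Rank `6` for every Picard quartic over a number field `K ⊇ ℚ(ω)`**, from the twisted Lefschetz formula
alone (`picard_nontrivial_tateModule_deuringDatum` + the dichotomy). [cite: Upton2009, §2] -/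
theorem picard_finrank_tateModule_eq_six_deuringDatum
    (hX3 : ∀ (k : Type) [Field k] [Fintype k] (Ω : Type) [Field Ω] [Algebra k Ω] [IsAlgClosed Ω]
      [Algebra.IsAlgebraic k Ω] (p : ℕ) [Fact p.Prime] (ℓ : ℕ) [Fact ℓ.Prime] (f : k[X]),
      (p : k) ≠ 0 → (ℓ : k) ≠ 0 → f.Separable → ¬ p ∣ f.natDegree →
      ∀ [Fact (Irreducible (superellipticPoly k Ω p f))] (φ : Ω ≃ₐ[k] Ω), (∀ x : Ω, φ x = x ^ Fintype.card k) →
      ∀ (ξ : CyclicCoverDeck Ω p),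
        LinearMap.trace ℚ_[ℓ] (RationalTateModule (SuperellipticPic k Ω p f) ℓ)
          (rationalTateRepresentation (Ω ≃ₐ[k] Ω) (SuperellipticPic k Ω p f) ℓ φ ∘ₗ
            rationalTateRepresentation (CyclicCoverDeck Ω p) (SuperellipticPic k Ω p f) ℓ ξ) =
          (Fintype.card k : ℚ_[ℓ]) + 1 -
            Nat.card {P : PlaceOver Ω (SuperellipticFunctionField k Ω p f) // φ • (ξ • P) = P}) :
    Module.finrank ℤ_[3] (TateModule (GeomPic K 3 (f.map (algebraMap ℤ K))) 3) = 6 :=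
  haveI := picard_nontrivial_tateModule_deuring (K := K) (f := f) hX3
  picard_finrank_tateModule_eq_six_of_nontrivial_deuring (K := K) (f := f) hX3

end PublicDeuring

end Literature.NumberTheory.GaloisRepresentations
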